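import Summits.Ventures.HodgeRepro2.T5FinitePlaceDecompAut
import Summits.Ventures.HodgeRepro2.T5FinitePlaceCM
import Summits.Ventures.HodgeRepro2.T5CMDecomposition

/-!
# One prime of the CM field above `v` ⟹ `[K_w : K⁺_v] = 2`; a `v`-adic square `θ` ⟹ two primes above `v`
(cell pub-hodge-repro2, seat p3)

Tier-5 N2 support, §N2.9.2 of route/T5-N2-route-3.md («completions») at the finite places — the CM-vocabulary form
of file 121 (T5FinitePlaceDecompAut) through file 97 (T5CMDecomposition: «`c • P = P` ⟺ exactly one prime of `K`
above `P ∩ 𝓞_{K⁺}`») and file 120 (T5FinitePlaceCM): on Mathlib's `IsCMField K` with the datum `θ = y²`,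
`c y ≠ y`, a finite place `v` of `K⁺` and `w ∣ v`:
* `finrank_eq_two_of_ncard_primesOver_eq_one` — **one prime above `v` ⟹ `[K_w : K⁺_v] = 2`**, and
  `not_isSquare_of_ncard_primesOver_eq_one` — `θ` is then not a `v`-adic square;
* `ncard_primesOver_ne_one_of_isSquare` / `complexConj_smul_ne_of_isSquare` — **`θ` a `v`-adic square ⟹ `v` has more
  than one prime above it in `K`** (so, with `Σ e f = 2`, exactly two — the «split» case of row N2.2.5), and then
  `finrank_eq_one_of_isSquare` — `K_w = K⁺_v` at every such `w`.
This is the direction «`θ ∈ (K⁺_v)^{×2}` ⟹ `v` splits» of row N2.2.5's dictionary in kernel; the converse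
(«`v` splits ⟹ `θ` a `v`-adic square») is the global count (weak approximation / local degree `e·f`), NOT here.
Mathlib + files 97, 120, 121 only. No display; no device. §8(d): uses an L-value-free non-vanishing device: NO.
-/

namespace Summit.Ventures.HodgeRepro2.T5FinitePlaceCMDecomp

open IsDedekindDomain IsDedekindDomain.HeightOneSpectrum NumberField NumberField.IsCMField Module
open scoped Summit.Ventures.HodgeRepro2.T5FinitePlaceLiesOver Pointwise
open Summit.Ventures.HodgeRepro2.T5FinitePlaceLiesOver Summit.Ventures.HodgeRepro2.T5FinitePlaceQuadratic
  Summit.Ventures.HodgeRepro2.T5FinitePlaceDecompAut Summit.Ventures.HodgeRepro2.T5FinitePlaceCM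
  Summit.Ventures.HodgeRepro2.T5CMDecomposition

variable (K : Type*) [Field K] [NumberField K] [IsCMField K]
variable {θ : maximalRealSubfield K} {y : K}
variable (hθ : algebraMap (maximalRealSubfield K) K θ = y ^ 2) (hy : complexConj K y ≠ y)
variable (v : HeightOneSpectrum (𝓞 (maximalRealSubfield K))) (w : HeightOneSpectrum (𝓞 K))
  [w.asIdeal.LiesOver v.asIdeal]

include hy in
/-- `y ≠ 0` when `c y ≠ y`. -/
theorem y_ne_zero : y ≠ 0 := fun h => hy (by rw [h, map_zero])

omit [NumberField K] [IsCMField K] in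
/-- `w ∩ 𝓞_{K⁺} = v`. -/
theorem under_eq : Ideal.under (𝓞 (maximalRealSubfield K)) w.asIdeal = v.asIdeal :=
  (Ideal.LiesOver.over (P := w.asIdeal) (p := v.asIdeal)).symm

include hθ hy in
/-- **`c • w = w` ⟹ `θ` is not a `v`-adic square.** -/
theorem not_isSquare_of_complexConj_smul_eq (hw : complexConj K • w.asIdeal = w.asIdeal) :
    ¬ IsSquare (algebraMap (maximalRealSubfield K) (v.adicCompletion (maximalRealSubfield K)) θ) :=
  not_isSquare_of_smul_eq v w hθ.symm (span_pair_eq_top K hy) (y_ne_zero K hy) (complexConj K)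
    (complexConj_apply_eq_neg K hθ hy) hw

include hθ hy w in
/-- **ONE prime of `K` above `v` ⟹ `θ` is not a `v`-adic square** (file 97's dictionary for `c • w = w`;
`w` is any prime above `v`). -/
theorem not_isSquare_of_ncard_primesOver_eq_one (h1 : (v.asIdeal.primesOver (𝓞 K)).ncard = 1) :
    ¬ IsSquare (algebraMap (maximalRealSubfield K) (v.adicCompletion (maximalRealSubfield K)) θ) :=
  not_isSquare_of_complexConj_smul_eq K hθ hy v w
    ((complexConj_smul_eq_iff K w.asIdeal).mpr (by rw [under_eq K v w]; exact h1))

include hθ hy in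
/-- **ONE prime of `K` above `v` ⟹ `[K_w : K⁺_v] = 2`.** -/
theorem finrank_eq_two_of_ncard_primesOver_eq_one (h1 : (v.asIdeal.primesOver (𝓞 K)).ncard = 1) :
    finrank (v.adicCompletion (maximalRealSubfield K)) (w.adicCompletion K) = 2 :=
  (T5FinitePlaceCM.finrank_eq_two_iff_not_isSquare K hθ hy v w).mpr
    (not_isSquare_of_ncard_primesOver_eq_one K hθ hy v w h1)

include hθ hy in
/-- **`θ` a `v`-adic square ⟹ `c` moves `w`.** -/
theorem complexConj_smul_ne_of_isSquare
    (hsq : IsSquare (algebraMap (maximalRealSubfield K) (v.adicCompletion (maximalRealSubfield K)) θ)) :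
    complexConj K • w.asIdeal ≠ w.asIdeal :=
  fun hw => not_isSquare_of_complexConj_smul_eq K hθ hy v w hw hsq

include hθ hy w in
/-- **`θ` a `v`-adic square ⟹ `v` has MORE THAN ONE prime of `K` above it** (the split case; `w` is any prime
above `v`). -/
theorem ncard_primesOver_ne_one_of_isSquare
    (hsq : IsSquare (algebraMap (maximalRealSubfield K) (v.adicCompletion (maximalRealSubfield K)) θ)) :
    (v.asIdeal.primesOver (𝓞 K)).ncard ≠ 1 := by
  intro h1
  exact complexConj_smul_ne_of_isSquare K hθ hy v w hsq
    ((complexConj_smul_eq_iff K w.asIdeal).mpr (by rw [under_eq K v w]; exact h1))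

include hθ hy in
/-- `θ` a `v`-adic square ⟹ `K_w = K⁺_v` (file 120) — at EVERY `w ∣ v`. -/
theorem finrank_eq_one_of_isSquare
    (hsq : IsSquare (algebraMap (maximalRealSubfield K) (v.adicCompletion (maximalRealSubfield K)) θ)) :
    finrank (v.adicCompletion (maximalRealSubfield K)) (w.adicCompletion K) = 1 :=
  (T5FinitePlaceCM.finrank_eq_one_iff_isSquare K hθ hy v w).mpr hsq

end Summit.Ventures.HodgeRepro2.T5FinitePlaceCMDecomp
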